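/-
VALUE = THEOREM, NOT summit progress (cell b2b-lgcu-borel, gen 25); crux 14079 untouched.
-/
import Mathlib
import Summits.MatrixMultiplication.MatrixMultiplication.Theorems.LieRankDesigns.Negative.Basics
import Summits.MatrixMultiplication.MatrixMultiplication.Theorems.SubgroupIdentityDesigns.Negative.GLmLevelOneCertificates

/-!
# Root elements `1 + c ⊗ φ` in a subgroup of `GL_m(𝔽_p)`: algebra, order-`p²` pairs, and the
# motion of a root group under a non-normal small Sylow subgroup

VALUE = THEOREM (group-theoretic infrastructure for structure laws on HYPOTHETICAL level-one
witnesses of the crux `SubgroupIdentityDesigns`), NOT summit progress.  The crux item is neither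
restated nor weakened; this file is a `--supports` helper under `Negative/` (it is used by
`TransvectionSylow`, the transvection dichotomy at `m = 3`).

A transvection of `V = 𝔽_p^m` is `t = 1 + c ⊗ φ` (`c ≠ 0`, `φ ≠ 0`, `φ(c) = 0`), written with
`Matrix.vecMulVec c φ`.

§1  Matrix algebra: `(c ⊗ φ)(c' ⊗ φ') = φ(c') · c ⊗ φ'`; powers `(1 + N)^k = 1 + kN` and inverse
`1 − N` for `N² = 0`; conjugates `k t k⁻¹ = 1 + (k c) ⊗ (φ k⁻¹)` (again root data; `k c ≠ 0` is
`glm_mulVec_ne_zero` of `GLmLevelOneCertificates`); and the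
COMMUTATOR WITH ONE INCIDENCE: if `φ'(c) = 0` then `t t' t⁻¹ t'⁻¹ = 1 + φ(c') · c ⊗ φ'`.

§2 (`sq_dvd_card_of_pair`)  Two root elements `1 + c ⊗ φ`, `1 + c₂ ⊗ φ₂` of `H` with all four
products zero (`φ(c) = φ₂(c₂) = φ(c₂) = φ₂(c) = 0`) and `c ⊗ φ`, `c₂ ⊗ φ₂` independent span the
elementary abelian subgroup `{1 + λ c ⊗ φ + μ c₂ ⊗ φ₂}` of order `p²`; hence `p² ∣ |H|`.
`indep_same_centre` is the independence criterion used for a commutator and its parent.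

§3 (`exists_conj_not_mem`)  If `H ∋ t = 1 + c ⊗ φ` has a NON-normal Sylow `p`-subgroup of order
`≤ p`, some `H`-conjugate of `t` lies outside the root group `{1 + λ c ⊗ φ}`: otherwise that root
group is a normal subgroup of `H` of order `p = |H|_p`, a normal Sylow subgroup, and then every
Sylow `p`-subgroup of `H` is normal (`Sylow.unique_of_normal`).

HONEST SCOPE.  Pure algebra / group theory; no design, no TPP.  Sorry-free; standard axioms.
-/

set_option linter.dupNamespace false

noncomputable section

open scoped BigOperators Classical Matrix

namespace Summit.MatrixMultiplication.MatrixMultiplication.Theorems.SubgroupIdentityDesigns.Negative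
namespace RootElements

open Summit.MatrixMultiplication.MatrixMultiplication.Theorems.LieRankDesigns.Negative (GLm Mat)
open Matrix (vecMulVec)

variable {p m : ℕ} [hp : Fact p.Prime]

/-! ## 1. Matrix algebra of root elements -/

section Algebra

/-- `(c ⊗ φ)(c' ⊗ φ') = φ(c') · (c ⊗ φ')`. -/
theorem vmv_mul_vmv (c φ c' φ' : Fin m → ZMod p) :
    vecMulVec c φ * vecMulVec c' φ' = (φ ⬝ᵥ c') • vecMulVec c φ' := by
  rw [Matrix.vecMulVec_mul_vecMulVec, Matrix.vecMulVec_smul]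

/-- Powers of a unipotent element `1 + N` with `N² = 0`: `(1 + N)^k = 1 + k N`. -/
theorem coe_pow_of_sq_zero {t : GLm p m} {N : Mat p m} (ht : (t : Mat p m) = 1 + N)
    (hN : N * N = 0) (k : ℕ) : ((t ^ k : GLm p m) : Mat p m) = 1 + (k : ZMod p) • N := by
  induction k with
  | zero => simp
  | succ k ih =>
    rw [pow_succ, Units.val_mul, ih, ht]
    simp only [Nat.cast_succ, add_smul, one_smul, add_mul, mul_add, one_mul, mul_one,
      Matrix.smul_mul, hN, smul_zero, add_zero]
    abel

/-- Inverse of a unipotent element `1 + N` with `N² = 0`: `(1 + N)⁻¹ = 1 − N`. -/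
theorem coe_inv_of_sq_zero {t : GLm p m} {N : Mat p m} (ht : (t : Mat p m) = 1 + N)
    (hN : N * N = 0) : ((t⁻¹ : GLm p m) : Mat p m) = 1 - N := by
  apply Units.inv_eq_of_mul_eq_one_right
  simp only [ht, add_mul, mul_sub, one_mul, mul_one, hN]
  abel

/-- Conjugate of a root element: `k (1 + c ⊗ φ) k⁻¹ = 1 + (k c) ⊗ (φ k⁻¹)`. -/
theorem coe_conj (t k : GLm p m) {c φ : Fin m → ZMod p}
    (ht : (t : Mat p m) = 1 + vecMulVec c φ) :
    ((k * t * k⁻¹ : GLm p m) : Mat p m) =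
      1 + vecMulVec ((k : Mat p m) *ᵥ c) (φ ᵥ* ((k⁻¹ : GLm p m) : Mat p m)) := by
  rw [Units.val_mul, Units.val_mul, ht, mul_add, mul_one, add_mul, Units.mul_inv,
    Matrix.mul_vecMulVec, Matrix.vecMulVec_mul]

/-- The conjugate data are again root data: `(φ k⁻¹)(k c) = φ(c)`. -/
theorem conj_dot (k : GLm p m) (c φ : Fin m → ZMod p) :
    (φ ᵥ* ((k⁻¹ : GLm p m) : Mat p m)) ⬝ᵥ ((k : Mat p m) *ᵥ c) = φ ⬝ᵥ c := by
  rw [← Matrix.dotProduct_mulVec, Matrix.mulVec_mulVec, ← Units.val_mul, inv_mul_cancel,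
    Units.val_one, Matrix.one_mulVec]

/-- `φ k⁻¹ ≠ 0` when `φ ≠ 0`. -/
theorem vecMul_inv_ne_zero (k : GLm p m) {φ : Fin m → ZMod p} (hφ : φ ≠ 0) :
    φ ᵥ* ((k⁻¹ : GLm p m) : Mat p m) ≠ 0 := by
  intro h
  apply hφ
  have := congrArg (fun ψ => ψ ᵥ* (k : Mat p m)) h
  simpa only [Matrix.vecMul_vecMul, ← Units.val_mul, inv_mul_cancel, Units.val_one,
    Matrix.vecMul_one, Matrix.zero_vecMul] using this

/-- **Commutator with one incidence.**  For root elements `t = 1 + c ⊗ φ`, `s = 1 + c' ⊗ φ'`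
with `φ'(c) = 0`:  `t s t⁻¹ s⁻¹ = 1 + φ(c') · c ⊗ φ'`. -/
theorem coe_comm (t s : GLm p m) {c φ c' φ' : Fin m → ZMod p}
    (ht : (t : Mat p m) = 1 + vecMulVec c φ) (hs : (s : Mat p m) = 1 + vecMulVec c' φ')
    (hφc : φ ⬝ᵥ c = 0) (hφ'c' : φ' ⬝ᵥ c' = 0) (h0 : φ' ⬝ᵥ c = 0) :
    ((t * s * t⁻¹ * s⁻¹ : GLm p m) : Mat p m) = 1 + vecMulVec c ((φ ⬝ᵥ c') • φ') := by
  have hnn : vecMulVec c φ * vecMulVec c φ = 0 := by rw [vmv_mul_vmv, hφc, zero_smul]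
  have hn'n' : vecMulVec c' φ' * vecMulVec c' φ' = 0 := by rw [vmv_mul_vmv, hφ'c', zero_smul]
  have hn'n : vecMulVec c' φ' * vecMulVec c φ = 0 := by rw [vmv_mul_vmv, h0, zero_smul]
  have hnn' : vecMulVec c φ * vecMulVec c' φ' = vecMulVec c ((φ ⬝ᵥ c') • φ') := by
    rw [vmv_mul_vmv, Matrix.vecMulVec_smul]
  set M := vecMulVec c ((φ ⬝ᵥ c') • φ') with hM
  have hMn : M * vecMulVec c φ = 0 := by
    rw [hM, vmv_mul_vmv, smul_dotProduct, h0, smul_zero, zero_smul]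
  have hMn' : M * vecMulVec c' φ' = 0 := by
    rw [hM, vmv_mul_vmv, smul_dotProduct, hφ'c', smul_zero, zero_smul]
  rw [Units.val_mul, Units.val_mul, Units.val_mul, coe_inv_of_sq_zero ht hnn,
    coe_inv_of_sq_zero hs hn'n', ht, hs]
  have e1 : (1 + vecMulVec c φ) * (1 + vecMulVec c' φ') =
      1 + vecMulVec c φ + vecMulVec c' φ' + M := by
    simp only [add_mul, mul_add, one_mul, mul_one, hnn']; abel
  have e2 : (1 + vecMulVec c φ + vecMulVec c' φ' + M) * (1 - vecMulVec c φ) =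
      1 + vecMulVec c' φ' + M := by
    simp only [mul_sub, mul_one, add_mul, one_mul, hnn, hn'n, hMn]; abel
  have e3 : (1 + vecMulVec c' φ' + M) * (1 - vecMulVec c' φ') = 1 + M := by
    simp only [mul_sub, mul_one, add_mul, one_mul, hn'n', hMn']; abel
  rw [e1, e2, e3]

end Algebra

/-! ## 2. Two orthogonal root elements give a subgroup of order `p²` -/

section Pair

variable {H : Subgroup (GLm p m)}

/-- **`p² ∣ |H|` from an orthogonal independent pair of root elements of `H`.** -/
theorem sq_dvd_card_of_pair {t s : GLm p m} (htH : t ∈ H) (hsH : s ∈ H)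
    {c φ c₂ φ₂ : Fin m → ZMod p}
    (ht : (t : Mat p m) = 1 + vecMulVec c φ) (hs : (s : Mat p m) = 1 + vecMulVec c₂ φ₂)
    (h11 : φ ⬝ᵥ c = 0) (h22 : φ₂ ⬝ᵥ c₂ = 0) (h12 : φ ⬝ᵥ c₂ = 0) (h21 : φ₂ ⬝ᵥ c = 0)
    (hind : ∀ a b : ZMod p, a • vecMulVec c φ + b • vecMulVec c₂ φ₂ = 0 → a = 0 ∧ b = 0) :
    p ^ 2 ∣ Nat.card H := by
  set n := vecMulVec c φ with hn
  set n₂ := vecMulVec c₂ φ₂ with hn₂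
  have hnn : n * n = 0 := by rw [hn, vmv_mul_vmv, h11, zero_smul]
  have hn₂n₂ : n₂ * n₂ = 0 := by rw [hn₂, vmv_mul_vmv, h22, zero_smul]
  have hnn₂ : n * n₂ = 0 := by rw [hn, hn₂, vmv_mul_vmv, h12, zero_smul]
  have hn₂n : n₂ * n = 0 := by rw [hn, hn₂, vmv_mul_vmv, h21, zero_smul]
  -- the product formula
  have hprod : ∀ a b a' b' : ZMod p,
      (1 + a • n + b • n₂) * (1 + a' • n + b' • n₂) = 1 + (a + a') • n + (b + b') • n₂ := by
    intro a b a' b'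
    simp only [add_mul, mul_add, one_mul, mul_one, Matrix.smul_mul, Matrix.mul_smul, hnn, hn₂n₂,
      hnn₂, hn₂n, smul_zero, add_zero, add_smul]
    abel
  -- the elements `t^a s^b`
  have hpow : ∀ a b : ℕ, ((t ^ a * s ^ b : GLm p m) : Mat p m) =
      1 + (a : ZMod p) • n + (b : ZMod p) • n₂ := by
    intro a b
    rw [Units.val_mul, coe_pow_of_sq_zero ht hnn, coe_pow_of_sq_zero hs hn₂n₂]
    have := hprod a 0 0 b
    simp only [zero_smul, add_zero, zero_add] at this
    rw [this]
  -- the subgroup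
  let Y : Subgroup (GLm p m) :=
    { carrier := {g | ∃ a b : ZMod p, (g : Mat p m) = 1 + a • n + b • n₂}
      one_mem' := ⟨0, 0, by simp⟩
      mul_mem' := by
        rintro g g' ⟨a, b, hg⟩ ⟨a', b', hg'⟩
        exact ⟨a + a', b + b', by rw [Units.val_mul, hg, hg', hprod]⟩
      inv_mem' := by
        rintro g ⟨a, b, hg⟩
        refine ⟨-a, -b, Units.inv_eq_of_mul_eq_one_right ?_⟩
        rw [hg, hprod, add_neg_cancel, add_neg_cancel, zero_smul, zero_smul, add_zero, add_zero] }
  have hYH : Y ≤ H := by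
    rintro g ⟨a, b, hg⟩
    have hg' : g = t ^ a.val * s ^ b.val := by
      apply Units.ext
      rw [hg, hpow, ZMod.natCast_zmod_val, ZMod.natCast_zmod_val]
    rw [hg']
    exact H.mul_mem (H.pow_mem htH _) (H.pow_mem hsH _)
  -- its order is `p²`
  have hcardY : Nat.card Y = p ^ 2 := by
    let e : ZMod p × ZMod p → Y := fun ab =>
      ⟨t ^ ab.1.val * s ^ ab.2.val, ab.1, ab.2, by rw [hpow, ZMod.natCast_zmod_val,
        ZMod.natCast_zmod_val]⟩
    have hbij : Function.Bijective e := by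
      constructor
      · rintro ⟨a, b⟩ ⟨a', b'⟩ h
        have h' : ((t ^ a.val * s ^ b.val : GLm p m) : Mat p m) =
            ((t ^ a'.val * s ^ b'.val : GLm p m) : Mat p m) :=
          congrArg (fun y : Y => ((y : GLm p m) : Mat p m)) h
        rw [hpow, hpow, ZMod.natCast_zmod_val, ZMod.natCast_zmod_val, ZMod.natCast_zmod_val,
          ZMod.natCast_zmod_val] at h'
        have hzero : (a - a') • n + (b - b') • n₂ = 0 := by
          calc (a - a') • n + (b - b') • n₂
              = (1 + a • n + b • n₂) - (1 + a' • n + b' • n₂) := by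
                rw [sub_smul, sub_smul]; abel
            _ = 0 := sub_eq_zero.mpr h'
        obtain ⟨ha, hb⟩ := hind _ _ hzero
        rw [sub_eq_zero] at ha hb
        rw [ha, hb]
      · rintro ⟨g, a, b, hg⟩
        refine ⟨(a, b), Subtype.ext (Units.ext ?_)⟩
        show ((t ^ a.val * s ^ b.val : GLm p m) : Mat p m) = (g : Mat p m)
        rw [hpow, ZMod.natCast_zmod_val, ZMod.natCast_zmod_val, hg]
    rw [← Nat.card_eq_of_bijective e hbij, Nat.card_prod, Nat.card_zmod, pow_two]
  rw [← hcardY]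
  exact Subgroup.card_dvd_of_le hYH

end Pair

/-! ## 3. A non-normal small Sylow subgroup moves the root group of `t` -/

section Move

variable {H : Subgroup (GLm p m)}

/-- **Some conjugate leaves the root group.**  If `t = 1 + c ⊗ φ ∈ H` (`c, φ ≠ 0`, `φ(c) = 0`)
and `H` has a non-normal Sylow `p`-subgroup of order `≤ p`, then some `k ∈ H` conjugates `t`
outside `{1 + λ · c ⊗ φ}`. -/
theorem exists_conj_not_mem {t : GLm p m} (htH : t ∈ H) {c φ : Fin m → ZMod p}
    (ht : (t : Mat p m) = 1 + vecMulVec c φ) (hc : c ≠ 0) (hφ : φ ≠ 0) (hφc : φ ⬝ᵥ c = 0)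
    (P₀ : Sylow p H) (hP₀ : ¬ (P₀ : Subgroup H).Normal) (hcard : Nat.card P₀ ≤ p) :
    ∃ k ∈ H, ∀ a : ZMod p, ((k * t * k⁻¹ : GLm p m) : Mat p m) ≠ 1 + a • vecMulVec c φ := by
  set n := vecMulVec c φ with hn
  have hnn : n * n = 0 := by rw [hn, vmv_mul_vmv, hφc, zero_smul]
  have hn0 : n ≠ 0 := Matrix.vecMulVec_ne_zero hc hφ
  by_contra hall
  push Not at hall
  -- the root group `X = {1 + a n}` as a subgroup of `GL`
  have hprod : ∀ a a' : ZMod p, (1 + a • n) * (1 + a' • n) = 1 + (a + a') • n := by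
    intro a a'
    simp only [add_mul, mul_add, one_mul, mul_one, Matrix.smul_mul, Matrix.mul_smul, hnn,
      smul_zero, add_zero, add_smul]
    abel
  let X : Subgroup (GLm p m) :=
    { carrier := {g | ∃ a : ZMod p, (g : Mat p m) = 1 + a • n}
      one_mem' := ⟨0, by simp⟩
      mul_mem' := by
        rintro g g' ⟨a, hg⟩ ⟨a', hg'⟩
        exact ⟨a + a', by rw [Units.val_mul, hg, hg', hprod]⟩
      inv_mem' := by
        rintro g ⟨a, hg⟩
        refine ⟨-a, Units.inv_eq_of_mul_eq_one_right ?_⟩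
        rw [hg, hprod, add_neg_cancel, zero_smul, add_zero] }
  have hpow : ∀ a : ℕ, ((t ^ a : GLm p m) : Mat p m) = 1 + (a : ZMod p) • n :=
    coe_pow_of_sq_zero ht hnn
  have hXH : X ≤ H := by
    rintro g ⟨a, hg⟩
    have hg' : g = t ^ a.val := Units.ext (by rw [hg, hpow, ZMod.natCast_zmod_val])
    rw [hg']
    exact H.pow_mem htH _
  have hcardX : Nat.card X = p := by
    let e : ZMod p → X := fun a => ⟨t ^ a.val, a, by rw [hpow, ZMod.natCast_zmod_val]⟩
    have hbij : Function.Bijective e := by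
      constructor
      · intro a a' h
        have h' : ((t ^ a.val : GLm p m) : Mat p m) = ((t ^ a'.val : GLm p m) : Mat p m) :=
          congrArg (fun y : X => ((y : GLm p m) : Mat p m)) h
        rw [hpow, hpow, ZMod.natCast_zmod_val, ZMod.natCast_zmod_val, add_right_inj] at h'
        by_contra hne
        apply hn0
        have := congrArg (fun M : Mat p m => (a - a')⁻¹ • (M - a' • n)) h'
        simp only [sub_self, smul_zero] at this
        rw [← sub_smul, smul_smul, inv_mul_cancel₀ (sub_ne_zero.mpr hne), one_smul] at this
        exact this
      · rintro ⟨g, a, hg⟩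
        refine ⟨a, Subtype.ext (Units.ext ?_)⟩
        show ((t ^ a.val : GLm p m) : Mat p m) = (g : Mat p m)
        rw [hpow, ZMod.natCast_zmod_val, hg]
    rw [← Nat.card_eq_of_bijective e hbij, Nat.card_zmod]
  -- `X` is normalised by `H`
  have hconj : ∀ k ∈ H, ∀ g ∈ X, k * g * k⁻¹ ∈ X := by
    rintro k hk g ⟨a, hg⟩
    obtain ⟨b, hb⟩ := hall k hk
    have hg' : g = t ^ a.val := Units.ext (by rw [hg, hpow, ZMod.natCast_zmod_val])
    have hbb : (b • n) * (b • n) = 0 := by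
      rw [Matrix.smul_mul, Matrix.mul_smul, hnn, smul_zero, smul_zero]
    refine ⟨(a.val : ZMod p) * b, ?_⟩
    rw [hg', ← conj_pow, coe_pow_of_sq_zero hb hbb, smul_smul]
  -- the trace of `X` in `H` is a normal subgroup of order `p = |H|_p`
  let XH : Subgroup H := X.subgroupOf H
  have hXHn : XH.Normal := by
    refine ⟨fun x hx k => ?_⟩
    rw [Subgroup.mem_subgroupOf] at hx ⊢
    simpa only [Subgroup.coe_mul, Subgroup.coe_inv] using hconj k k.2 x hx
  have hcardXH : Nat.card XH = p := by
    rw [Nat.card_congr (Subgroup.subgroupOfEquivOfLe hXH).toEquiv, hcardX]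
  have hdvd : p ∣ Nat.card H := by
    have h := Subgroup.card_dvd_of_le hXH
    rwa [hcardX] at h
  have hfac : (Nat.card H).factorization p = 1 := by
    have h1 : 1 ≤ (Nat.card H).factorization p :=
      hp.out.factorization_pos_of_dvd Nat.card_pos.ne' hdvd
    have h2 : p ^ (Nat.card H).factorization p ≤ p ^ 1 := by
      rw [← P₀.card_eq_multiplicity, pow_one]; exact hcard
    have h3 : (Nat.card H).factorization p ≤ 1 := by
      by_contra h
      exact absurd h2 (not_le.mpr (Nat.pow_lt_pow_right hp.out.one_lt (by omega)))
    omega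
  have hS : Nat.card XH = p ^ (Nat.card H).factorization p := by rw [hfac, pow_one, hcardXH]
  let S : Sylow p H := Sylow.ofCard XH hS
  have hSn : (S : Subgroup H).Normal := hXHn
  haveI := Sylow.unique_of_normal S hSn
  have hPS : P₀ = S := Subsingleton.elim _ _
  rw [hPS] at hP₀
  exact hP₀ hSn

end Move

/-! ## 4. Independence of a commutator and its parent -/

section Indep

/-- Independence of `c ⊗ φ` and `c ⊗ ψ` from a separating vector: if `c ≠ 0`, `φ(d) ≠ 0`,
`ψ = s • ψ₀` with `s ≠ 0`, `ψ₀ ≠ 0`, `ψ₀(d) = 0`, then `a c⊗φ + b c⊗ψ = 0 ⇒ a = b = 0`. -/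
theorem indep_same_centre {c d φ ψ₀ : Fin m → ZMod p} {s : ZMod p} (hc : c ≠ 0)
    (hφd : φ ⬝ᵥ d ≠ 0) (hs : s ≠ 0) (hψ₀ : ψ₀ ≠ 0) (hψ₀d : ψ₀ ⬝ᵥ d = 0) (a b : ZMod p)
    (h : a • vecMulVec c φ + b • vecMulVec c (s • ψ₀) = 0) : a = 0 ∧ b = 0 := by
  have h' : vecMulVec c (a • φ + (b * s) • ψ₀) = 0 := by
    rw [Matrix.vecMulVec_add, Matrix.vecMulVec_smul, Matrix.vecMulVec_smul, ← h,
      Matrix.vecMulVec_smul, smul_smul]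
  rw [Matrix.vecMulVec_eq_zero] at h'
  rcases h' with h' | h'
  · exact absurd h' hc
  · have hd := congrArg (fun χ => χ ⬝ᵥ d) h'
    simp only [add_dotProduct, smul_dotProduct, hψ₀d, smul_eq_mul, mul_zero, add_zero,
      zero_dotProduct] at hd
    have ha : a = 0 := (mul_eq_zero.mp hd).resolve_right hφd
    refine ⟨ha, ?_⟩
    rw [ha, zero_smul, zero_add, smul_eq_zero] at h'
    rcases h' with h' | h'
    · exact (mul_eq_zero.mp h').resolve_right hs
    · exact absurd h' hψ₀

end Indep

end RootElements
end Summit.MatrixMultiplication.MatrixMultiplication.Theorems.SubgroupIdentityDesigns.Negative
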